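import Summits.FinalStateConjecture.FinalStateConjecture.Theses.EternalPapapetrou
import HarnessLib.Audit

/-!
# Birth skeleton (BC3) — crux `Theses.EternalPapapetrou.FarZoneEternalPapapetrou` (stmt-FinalStateConjecture-10034)

Registrar: planner-skel-stmt-FinalStateConjecture-10034-0, 2026-08-17 (route re-audit bin REPAIRABLE; published as
`Cruxes/FarZoneEternalPapapetrou/Lines/birth.lean`; BC3 of `run/shared/lean/lens3/_common/BC.md`).  The crux is FIXED
and concluded BY NAME:

  `Summit.FinalStateConjecture.FinalStateConjecture.Theses.EternalPapapetrou.FarZoneEternalPapapetrou`  (L)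

L = FAR-ZONE ETERNAL PAPAPETROU AT RELLICH ORDER: there is a finite `k` such that for `0 ≤ M`, `R > max(2M,0)`, every
eternal far chart `Φ` of the cylinder `Kerr.region 0 R = ℝ_t × {|x⃗| > R}` into a Ricci-flat spacetime whose deviation
`h = Φ^*g − g_M` (ingoing Kerr–Schild Schwarzschild `Kerr.bilin M 0`) is `C^k·(1/r)`-bounded UNIFORMLY IN `t` and
TWO-SIDED NON-RADIATING AT ORDER `1/r` (`r‖D^m ∂₀h‖ → 0` uniformly in `t`, `m < k`) makes `G = g_M + h` stationary near
infinity: a smooth `T` on some `{r > R₁}` with `G(T,T) < 0` and the coordinate Killing equation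
`DG·T + G(DT·,·) + G(·,DT·) = 0`.

## The cut (three named stubs; composition kernel-checked, no `sorry` outside `stub_*`)

The route's mechanism (temporal Fourier transform of the eternal limit; Rellich at `𝓘` for `λ ≠ 0`, polynomial hence
static remainder at `λ = 0`) does not output a Killing field directly: it outputs a STATIONARY CHART — eternal
coordinates `χ` near infinity, asymptotically time-aligned, in which the metric components `G̃` do not depend on `t`.
The skeleton cuts L along that intermediate object:

* `stub_stationaryChart` (the heart; XL, the analytic content of L in its natural "coordinate stationarity" form):
  under the hypotheses of L verbatim (same `∃ k` prefix, token-identical `let`s), there are `R₁ ≥ R`, maps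
  `χ T : E4 → E4` and a components field `G̃`, smooth at the relevant points, with
  `G y = G̃(χ y) ∘ (dχ_y × dχ_y)` on `{r > R₁}` (G is the pull-back of `G̃` by `χ`), `∂_{e₀} G̃ = 0` at the image points
  (`G̃` is `t`-independent there), `dχ_y (T y) = e₀` (T is the pull-back of `∂_t` of the stationary chart) and
  `T y → e₀` as `r → ∞` uniformly in `t` (the chart is asymptotically time-aligned: the eternal gauge is
  `C⁰`-asymptotic to the given one in the time direction).  This is Papapetrou's conclusion in its classical wording
  ("non-radiative ⇒ stationary in suitable coordinates"), at finite order and without periodicity.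
* `stub_killing_of_stationaryChart` (M; multivariable calculus on `E4`, no geometry library needed): if on an open
  `U` a bilinear-form field `G` is the pull-back `G̃(χ ·)∘(dχ × dχ)` of a field with `∂_e G̃ = 0` at the image, and
  `dχ(T) = e` on `U`, then `T` satisfies the coordinate Killing equation for `G` on `U` — the chain rule, the product
  rule for `y ↦ dχ_y (T y)` and the symmetry of `D²χ`; NO invertibility of `dχ` is needed (differentiate
  `dχ_y(T y) = e` along `v` to trade `dχ(DT·v)` for `−D²χ(T,v)`).
* `stub_timelike_near_infinity` (M; explicit Kerr–Schild algebra): for `0 ≤ M` and any `C` there are `R₂` and `η > 0`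
  such that at spatial radius `r > R₂` every form `β + g_M(y)` with `‖β‖·r ≤ C` is negative on every `v` with
  `‖v − e₀‖ ≤ η` (`g_M(e₀,e₀) = −1 + 2M/r`, `|ℓ(v)| ≤ 2‖v‖`, `H = M/r`): the timelike cone is stable at infinity.

`FarZoneEternalPapapetrou_of : Sig.stub_stationaryChart → Sig.stub_killing_of_stationaryChart → Sig.stub_timelike_near_infinity →
FarZoneEternalPapapetrou` is PROVED below
(≈ 45 lines: unpack the chart on `{r > R₁}`, enlarge the radius to `max R₁ (max R₂ R₃)` where `R₃` makes
`‖T − e₀‖ ≤ η`, get timelikeness from stub 3 fed with the `m = 0` instance of L's `C^k·(1/r)` bound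
(`‖D⁰h‖ = ‖h‖`), and the Killing equation from stub 2 on the open set `{r > R₁}` with `G := h + g_M`, `e := e₀`).
Its binders are the stub statements BY NAME (`Sig.stub_*`, token-identical to the registered signatures);
`farZoneEternalPapapetrou_of_stubs` and the three `example`s show the hand-over is definitional.

## Why this is an honest cut and not a costume (recorded for the critics)

* No stub is the crux or the summit in disguise.  Stub 1 replaces L's conclusion (a TIMELIKE KILLING field) by a
  different object (a STATIONARY CHART with an asymptotically aligned time leg): getting L from it needs the Lie-derivative
  identity of stub 2 and the cone estimate of stub 3, neither of which automation finds; stubs 2 and 3 are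
  library-grade lemmas with no spacetime in them.  The BC3 probes `stub → L` and `stub → FinalStateConjecture` by
  `exact? | simpa | simpa [·] | unfold; simpa | aesop | unfold; aesop` all FAIL (6/6; raw table in `Lines/birth.md`).
* The difficulty of L sits in ONE NAMED analytic stub on purpose: L is itself a single Liouville theorem (rank-2 crux of
  the route), and its further cut along the temporal spectrum (route header, TWO-LAYER PLAN: L1 eternal gauge → L2
  fixed-frequency Rellich–Carleman for `λ ≠ 0` → L3 infrared vertex `λ → 0`) needs distribution-valued temporal Fourier
  transforms of `h`, which the prelude cannot type yet; that cut is the lead's `Lines/<slug>.lean`, not the birth file.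
  Stub 1 is exactly the statement those three pieces assemble to (stationarity IN THE ETERNAL GAUGE), so a later line
  refines stub 1 without touching stubs 2–3 or the composition.

Disproof used: none exists for this crux (`ledger crux ls stmt-FinalStateConjecture-10034`: no workfiles, no
`Disproof.lean`, payload `disproof_path` absent, 2026-08-17) — no `_false_without_` obligation to honour, no landed
`Theorems/FarZoneEternalPapapetrou/Negative/*`.  Negatives index (1 entry, `not_UniformPhotonSphereChannels`, an ODE
channel estimate of route PhotonSphereChannels): unrelated; no stub instantiates it.  Refuter/grounder record on the
item (2026-08-15): elaborates, hypothesis class non-vacuous (exact Schwarzschild far charts), "new beyond print"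
(AlexakisSchlue2018 Thm 1.1/1.3, BicakScholtzTod2010, Papapetrou 1965 need periodicity or an expansion at `𝓘±`).
-/

set_option linter.dupNamespace false

noncomputable section

namespace Summit.FinalStateConjecture.FinalStateConjecture.Cruxes.FarZoneEternalPapapetrou.Birth

open scoped Manifold Topology ContDiff

/-! ## Legend: the three stub statements as named propositions (verbatim the registered signatures)

The skeleton audit (`ledger skeleton check`) admits as hypotheses of the concluding theorem only propositions referred
to BY NAME whose last name component is a declared stub; `Sig.stub_x` is verbatim the type of `stub_x` (the `example`s
after the stubs and `farZoneEternalPapapetrou_of_stubs` are the kernel checks that the two agree). -/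

/-- Statement of `stub_stationaryChart` (ETERNAL STATIONARY CHART; hypotheses of L verbatim, `let`s included). -/
def Sig.stub_stationaryChart : Prop :=
  ∃ k : ℕ, ∀ (M R C : ℝ), 0 ≤ M → max (2 * M) 0 < R → ∀ (𝓢 : Literature.Geometry.Lorentzian.Spacetime.{0} 4) [𝓢.metric.toPseudoRiemannianMetric.HasLeviCivita], 𝓢.metric.toPseudoRiemannianMetric.IsRicciFlat → ∀ (Φ : Literature.Geometry.Lorentzian.Kerr.region (0 : ℝ) R → 𝓢.carrier), IsLocalDiffeomorph 𝓘(ℝ, Literature.Geometry.Lorentzian.E4) (𝓡 4) (⊤ : ℕ∞) Φ → Function.Injective Φ → let B : Literature.Geometry.Lorentzian.ModelBackground := ⟨Literature.Geometry.Lorentzian.Kerr.region 0 R, Literature.Geometry.Lorentzian.Kerr.bilin M 0, fun x ↦ x 0, Literature.Geometry.Lorentzian.Kerr.radius 0⟩; let h : Literature.Geometry.Lorentzian.E4 → Literature.Geometry.Lorentzian.E4 →L[ℝ] Literature.Geometry.Lorentzian.E4 →L[ℝ] ℝ := 𝓢.deviationExtend B Φ; let hₜ : Literature.Geometry.Lorentzian.E4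 → Literature.Geometry.Lorentzian.E4 →L[ℝ] Literature.Geometry.Lorentzian.E4 →L[ℝ] ℝ := fun y ↦ fderiv ℝ h y (Literature.Geometry.Lorentzian.E4.basisVector 0); (∀ m ≤ k, ∀ x : Literature.Geometry.Lorentzian.Kerr.region (0 : ℝ) R, ‖iteratedFDeriv ℝ m h x.1‖ * Literature.Geometry.Lorentzian.Kerr.radius 0 x.1 ≤ C) → (∀ m < k, ∀ δ > (0 : ℝ), ∃ R' : ℝ, ∀ x : Literature.Geometry.Lorentzian.Kerr.region (0 : ℝ) R, R' < Literature.Geometry.Lorentzian.Kerr.radius 0 x.1 → ‖iteratedFDeriv ℝ m hₜ x.1‖ * Literature.Geometry.Lorentzian.Kerr.radius 0 x.1 ≤ δ) → ∃ (R₁ : ℝ) (χ T : Literature.Geometry.Lorentzian.E4 → Literature.Geometry.Lorentzian.E4) (Gs : Literature.Geometry.Lorentzian.E4 → Literature.Geometry.Lorentzian.E4 →L[ℝ] Literature.Geometry.Lorentzian.E4 →L[ℝ] ℝ), R ≤ R₁ ∧ (∀ y : Literature.Geometry.Lorentzian.E4, R₁ < Literature.Geometry.Lorentzian.Kerr.radius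 0 y → ContDiffAt ℝ (⊤ : ℕ∞) χ y ∧ ContDiffAt ℝ (⊤ : ℕ∞) T y ∧ ContDiffAt ℝ (⊤ : ℕ∞) Gs (χ y) ∧ fderiv ℝ Gs (χ y) (Literature.Geometry.Lorentzian.E4.basisVector 0) = 0 ∧ fderiv ℝ χ y (T y) = Literature.Geometry.Lorentzian.E4.basisVector 0 ∧ h y + Literature.Geometry.Lorentzian.Kerr.bilin M 0 y = (Gs (χ y)).bilinearComp (fderiv ℝ χ y) (fderiv ℝ χ y)) ∧ (∀ η > (0 : ℝ), ∃ R₂ : ℝ, ∀ y : Literature.Geometry.Lorentzian.E4, R₂ < Literature.Geometry.Lorentzian.Kerr.radius 0 y → ‖T y - Literature.Geometry.Lorentzian.E4.basisVector 0‖ ≤ η)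

/-- Statement of `stub_killing_of_stationaryChart` (KILLING FROM A STATIONARY CHART). -/
def Sig.stub_killing_of_stationaryChart : Prop :=
  ∀ (U : Set Literature.Geometry.Lorentzian.E4) (G Gs : Literature.Geometry.Lorentzian.E4 → Literature.Geometry.Lorentzian.E4 →L[ℝ] Literature.Geometry.Lorentzian.E4 →L[ℝ] ℝ) (χ T : Literature.Geometry.Lorentzian.E4 → Literature.Geometry.Lorentzian.E4) (e : Literature.Geometry.Lorentzian.E4), IsOpen U → (∀ y ∈ U, ContDiffAt ℝ (⊤ : ℕ∞) χ y ∧ ContDiffAt ℝ (⊤ : ℕ∞) T y ∧ ContDiffAt ℝ (⊤ : ℕ∞) Gs (χ y)) → (∀ y ∈ U, fderiv ℝ Gs (χ y) e = 0) → (∀ y ∈ U, fderiv ℝ χ y (T y) = e) → (∀ y ∈ U, G y = (Gs (χ y)).bilinearComp (fderiv ℝ χ y) (fderiv ℝ χ y)) → ∀ y ∈ U, ∀ v w : Literature.Geometry.Lorentzian.E4, (fderiv ℝ G y (T y)) v w + G y (fderiv ℝ T y v) w + G y v (fderiv ℝ T y w) = 0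

/-- Statement of `stub_timelike_near_infinity` (TIMELIKE CONE STABLE AT INFINITY). -/
def Sig.stub_timelike_near_infinity : Prop :=
  ∀ (M C : ℝ), 0 ≤ M → ∃ (R₂ η : ℝ), 0 < η ∧ ∀ y : Literature.Geometry.Lorentzian.E4, R₂ < Literature.Geometry.Lorentzian.Kerr.radius 0 y → ∀ β : Literature.Geometry.Lorentzian.E4 →L[ℝ] Literature.Geometry.Lorentzian.E4 →L[ℝ] ℝ, ‖β‖ * Literature.Geometry.Lorentzian.Kerr.radius 0 y ≤ C → ∀ v : Literature.Geometry.Lorentzian.E4, ‖v - Literature.Geometry.Lorentzian.E4.basisVector 0‖ ≤ η → (β + Literature.Geometry.Lorentzian.Kerr.bilin M 0 y) v v < 0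

/-! ## The three registered stubs (`sorry` only here; signatures def-free and fully qualified) -/

/-- **Registered stub 1 — ETERNAL STATIONARY CHART (the heart of L).**  Under the hypotheses of
`FarZoneEternalPapapetrou` verbatim (finite `k`; `0 ≤ M`, `max(2M,0) < R`; Ricci-flat `𝓢`; injective local-diffeo far
chart `Φ` of `Kerr.region 0 R`; `‖D^m h‖·r ≤ C` for `m ≤ k` uniformly in `t`; `r‖D^m ∂₀h‖ → 0` uniformly in `t` for
`m < k`), there are `R₁ ≥ R`, maps `χ T : E4 → E4` and a field `G̃ : E4 → (E4 →L E4 →L ℝ)` such that at every `y` with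
`r(y) > R₁`: `χ`, `T` are smooth at `y` and `G̃` at `χ y`; `∂_{e₀}G̃ (χ y) = 0`; `dχ_y (T y) = e₀`;
`h y + g_M y = G̃(χ y) ∘ (dχ_y × dχ_y)`; and `‖T y − e₀‖ → 0` as `r(y) → ∞` uniformly in `t`.
Why plausibly true: this is what the route's mechanism produces — in an eternal wave/Bondi gauge `χ` (C¹-asymptotic to
the given chart, uniformly in `t`) the temporal Fourier transform of `h` has no `λ ≠ 0` part near infinity (two-sided
non-radiation at order `1/r` kills both Jost branches `e^{±iλr*}/r`: Rellich at `𝓘⁺` and `𝓘⁻`) and a bounded, hence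
static, `λ = 0` remainder, i.e. the components `G̃ = χ_* G` are `t`-independent; `T := χ^*∂_t`.  Why it might fail: the
item's own risks (infrared vertex `λ → 0` of the quadratic Einstein terms; building the eternal gauge with no initial
slice; finite-order unique continuation from `𝓘±` fails for `□ + V`, arXiv:1412.1537 §3.5) plus one more: a Killing
field whose orbits drift radially forever would be stationary without a GLOBAL chart on a full cylinder `{r > R₁}`.
Size: XL / open.  Sources: arXiv:1504.04592 (Thm 1.1, 1.3), BicakScholtzTod2010, doi:10.1063/1.1704792,
doi:10.1007/BF02786703, arXiv:1312.1989, LindbladRodnianski2010. -/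
theorem stub_stationaryChart :
    ∃ k : ℕ, ∀ (M R C : ℝ), 0 ≤ M → max (2 * M) 0 < R → ∀ (𝓢 : Literature.Geometry.Lorentzian.Spacetime.{0} 4) [𝓢.metric.toPseudoRiemannianMetric.HasLeviCivita], 𝓢.metric.toPseudoRiemannianMetric.IsRicciFlat → ∀ (Φ : Literature.Geometry.Lorentzian.Kerr.region (0 : ℝ) R → 𝓢.carrier), IsLocalDiffeomorph 𝓘(ℝ, Literature.Geometry.Lorentzian.E4) (𝓡 4) (⊤ : ℕ∞) Φ → Function.Injective Φ → let B : Literature.Geometry.Lorentzian.ModelBackground := ⟨Literature.Geometry.Lorentzian.Kerr.region 0 R, Literature.Geometry.Lorentzian.Kerr.bilin M 0, fun x ↦ x 0, Literature.Geometry.Lorentzian.Kerr.radius 0⟩; let h : Literature.Geometry.Lorentzian.E4 → Literature.Geometry.Lorentzian.E4 →L[ℝ] Literature.Geometry.Lorentzian.E4 →L[ℝ] ℝ := 𝓢.deviationExtend B Φ; let hₜ : Literature.Geometry.Lorentzian.E4 → Literature.Geometry.Lorentzian.E4 →L[ℝ] Literature.Geometry.Lorentzian.E4 →L[ℝ] ℝ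 := fun y ↦ fderiv ℝ h y (Literature.Geometry.Lorentzian.E4.basisVector 0); (∀ m ≤ k, ∀ x : Literature.Geometry.Lorentzian.Kerr.region (0 : ℝ) R, ‖iteratedFDeriv ℝ m h x.1‖ * Literature.Geometry.Lorentzian.Kerr.radius 0 x.1 ≤ C) → (∀ m < k, ∀ δ > (0 : ℝ), ∃ R' : ℝ, ∀ x : Literature.Geometry.Lorentzian.Kerr.region (0 : ℝ) R, R' < Literature.Geometry.Lorentzian.Kerr.radius 0 x.1 → ‖iteratedFDeriv ℝ m hₜ x.1‖ * Literature.Geometry.Lorentzian.Kerr.radius 0 x.1 ≤ δ) → ∃ (R₁ : ℝ) (χ T : Literature.Geometry.Lorentzian.E4 → Literature.Geometry.Lorentzian.E4) (Gs : Literature.Geometry.Lorentzian.E4 → Literature.Geometry.Lorentzian.E4 →L[ℝ] Literature.Geometry.Lorentzian.E4 →L[ℝ] ℝ), R ≤ R₁ ∧ (∀ y : Literature.Geometry.Lorentzian.E4, R₁ < Literature.Geometry.Lorentzian.Kerr.radius 0 y → ContDiffAt ℝ (⊤ : ℕ∞) χ y ∧ ContDiffAt ℝ (⊤ : ℕ∞)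 T y ∧ ContDiffAt ℝ (⊤ : ℕ∞) Gs (χ y) ∧ fderiv ℝ Gs (χ y) (Literature.Geometry.Lorentzian.E4.basisVector 0) = 0 ∧ fderiv ℝ χ y (T y) = Literature.Geometry.Lorentzian.E4.basisVector 0 ∧ h y + Literature.Geometry.Lorentzian.Kerr.bilin M 0 y = (Gs (χ y)).bilinearComp (fderiv ℝ χ y) (fderiv ℝ χ y)) ∧ (∀ η > (0 : ℝ), ∃ R₂ : ℝ, ∀ y : Literature.Geometry.Lorentzian.E4, R₂ < Literature.Geometry.Lorentzian.Kerr.radius 0 y → ‖T y - Literature.Geometry.Lorentzian.E4.basisVector 0‖ ≤ η) := by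
  sorry

/-- **Registered stub 2 — KILLING FROM A STATIONARY CHART (coordinate Lie derivative of a pull-back).**  On an open
`U ⊆ E4`, let `G y = G̃(χ y) ∘ (dχ_y × dχ_y)` with `χ`, `T` smooth on `U` and `G̃` smooth at the image, `∂_e G̃ = 0` at
the image points and `dχ_y (T y) = e` on `U`.  Then `(𝓛_T G)(v,w) = (D_{T y}G)(v,w) + G(D_v T, w) + G(v, D_w T) = 0`
on `U`.  Proof sketch: chain + Leibniz rule give `D_{T}[G̃(χ·)(dχ v, dχ w)] = (∂_e G̃)(…)(=0) + G̃(D²χ(T,v), dχ w) +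
G̃(dχ v, D²χ(T,w))`; differentiating `dχ_y(T y) = e` along `v` on the open `U` gives `dχ(D_vT) = −D²χ(v,T) = −D²χ(T,v)`
(symmetry of second derivatives), which cancels both terms.  No invertibility of `dχ`.  Why it might fail: it does not
(textbook naturality of the Lie derivative under pull-back, written in coordinates); the Lean cost is `fderiv` of
`ContinuousLinearMap.bilinearComp` compositions and `IsSymmSndFDerivAt`.  Size: M.  Sources: ONeill1983 (Ch. 9,
Prop. 9.23/Lem. 9.21: `φ^*` and Killing fields), Mathlib `second_derivative_symmetric`. -/
theorem stub_killing_of_stationaryChart :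
    ∀ (U : Set Literature.Geometry.Lorentzian.E4) (G Gs : Literature.Geometry.Lorentzian.E4 → Literature.Geometry.Lorentzian.E4 →L[ℝ] Literature.Geometry.Lorentzian.E4 →L[ℝ] ℝ) (χ T : Literature.Geometry.Lorentzian.E4 → Literature.Geometry.Lorentzian.E4) (e : Literature.Geometry.Lorentzian.E4), IsOpen U → (∀ y ∈ U, ContDiffAt ℝ (⊤ : ℕ∞) χ y ∧ ContDiffAt ℝ (⊤ : ℕ∞) T y ∧ ContDiffAt ℝ (⊤ : ℕ∞) Gs (χ y)) → (∀ y ∈ U, fderiv ℝ Gs (χ y) e = 0) → (∀ y ∈ U, fderiv ℝ χ y (T y) = e) → (∀ y ∈ U, G y = (Gs (χ y)).bilinearComp (fderiv ℝ χ y) (fderiv ℝ χ y)) → ∀ y ∈ U, ∀ v w : Literature.Geometry.Lorentzian.E4, (fderiv ℝ G y (T y)) v w + G y (fderiv ℝ T y v) w + G y v (fderiv ℝ T y w) = 0 := by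
  sorry

/-- **Registered stub 3 — THE TIMELIKE CONE IS STABLE AT INFINITY (explicit Kerr–Schild algebra).**  For `0 ≤ M` and
any `C` there are `R₂` and `η > 0` such that at every `y ∈ E4` of Schwarzschild–Kerr–Schild radius `r(y) > R₂`, every
continuous bilinear form `β` with `‖β‖·r(y) ≤ C` and every `v` with `‖v − e₀‖ ≤ η` satisfy `(β + g_M(y))(v,v) < 0`.
Proof sketch: `g_M(y)(v,v) = η(v,v) + 2H ℓ(v)²` with `H = M/r ≥ 0`, `ℓ = (1, x⃗/r)` (`Kerr.bilin_apply`,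
`radius_zero_left`); for `‖v − e₀‖ ≤ η = 1/4`: `η(v,v) ≤ −(1−η)² + η² = −1/2`, `2Hℓ(v)² ≤ 8M‖v‖²/r`,
`|β(v,v)| ≤ C‖v‖²/r`, so the sum is `< 0` once `r > (25/8)(8M + |C|) + 1`.  Why it might fail: it does not (all
constants explicit; for `C < 0` the hypothesis is vacuous); cost is `EuclideanSpace` coordinate bookkeeping.  Size: M.
Sources: arXiv:0811.0354 §5.1 (Schwarzschild in ingoing Kerr–Schild form), arXiv:0706.0622 (32)–(35). -/
theorem stub_timelike_near_infinity :
    ∀ (M C : ℝ), 0 ≤ M → ∃ (R₂ η : ℝ), 0 < η ∧ ∀ y : Literature.Geometry.Lorentzian.E4, R₂ < Literature.Geometry.Lorentzian.Kerr.radius 0 y → ∀ β : Literature.Geometry.Lorentzian.E4 →L[ℝ] Literature.Geometry.Lorentzian.E4 →L[ℝ] ℝ, ‖β‖ * Literature.Geometry.Lorentzian.Kerr.radius 0 y ≤ C → ∀ v : Literature.Geometry.Lorentzian.E4, ‖v - Literature.Geometry.Lorentzian.E4.basisVector 0‖ ≤ η → (β + Literature.Geometry.Lorentzian.Kerr.bilin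 M 0 y) v v < 0 := by
  sorry

/-! Kernel checks: each `Sig.stub_x` is the type of `stub_x` (definitional `exact`). -/
example : Sig.stub_stationaryChart := stub_stationaryChart
example : Sig.stub_killing_of_stationaryChart := stub_killing_of_stationaryChart
example : Sig.stub_timelike_near_infinity := stub_timelike_near_infinity

/-! ## The composition: the crux BY NAME from the three stub statements (real proof, no `sorry`) -/

/-- **L from the three stubs.**  Binders are the named statements `Sig.stub_stationaryChart`,
`Sig.stub_killing_of_stationaryChart`, `Sig.stub_timelike_near_infinity` (verbatim the stub types); the conclusion is the route decl
`Theses.EternalPapapetrou.FarZoneEternalPapapetrou` itself.  Proof: take `k` from stub 1; given the data of L, stub 1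
yields `R₁, χ, T, G̃`; stub 3 yields `R₂, η`; the alignment clause of stub 1 yields `R₃` with `‖T − e₀‖ ≤ η` beyond
`R₃`; answer `R₁' := max R₁ (max R₂ R₃)` and the same `T`.  Smoothness of `T` on `{r > R₁'}` is pointwise from stub 1;
timelikeness at `y` is stub 3 with `β := h y`, whose bound `‖h y‖·r ≤ C` is the `m = 0` case of L's first hypothesis at
the point `⟨y, _⟩ : Kerr.region 0 R` (`max R 0 = R ≤ R₁ < r y`); the Killing equation is stub 2 on the open set
`U := {r > R₁}` (`Kerr.continuous_radius`) with `G := h + g_M`, `e := e₀`. -/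
theorem FarZoneEternalPapapetrou_of :
    Sig.stub_stationaryChart → Sig.stub_killing_of_stationaryChart → Sig.stub_timelike_near_infinity →
      Summit.FinalStateConjecture.FinalStateConjecture.Theses.EternalPapapetrou.FarZoneEternalPapapetrou := by
  intro hchart hkill htime
  unfold Sig.stub_stationaryChart at hchart
  unfold Sig.stub_killing_of_stationaryChart at hkill
  unfold Sig.stub_timelike_near_infinity at htime
  obtain ⟨k, hk⟩ := hchart
  refine ⟨k, ?_⟩
  intro M R C hM hR 𝓢 _inst hRic Φ hΦ hinj B h hₜ hbd hnr
  obtain ⟨R₁, χ, T, Gs, hRR₁, hloc, hTlim⟩ := hk M R C hM hR 𝓢 hRic Φ hΦ hinj hbd hnr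
  obtain ⟨R₂, η, hη, hneg⟩ := htime M C hM
  obtain ⟨R₃, hR₃⟩ := hTlim η hη
  have hRpos : 0 < R := lt_of_le_of_lt (le_max_right _ _) hR
  have hopen : IsOpen {y : Literature.Geometry.Lorentzian.E4 | R₁ < Literature.Geometry.Lorentzian.Kerr.radius 0 y} :=
    isOpen_lt continuous_const (Literature.Geometry.Lorentzian.Kerr.continuous_radius 0)
  -- the Killing equation on the whole open set `{r > R₁}` (stub 2 with `G := h + g_M`, `e := e₀`)
  have hKilling := hkill {y | R₁ < Literature.Geometry.Lorentzian.Kerr.radius 0 y}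
    (fun z ↦ h z + Literature.Geometry.Lorentzian.Kerr.bilin M 0 z) Gs χ T
    (Literature.Geometry.Lorentzian.E4.basisVector 0) hopen
    (fun y hy ↦ ⟨(hloc y hy).1, (hloc y hy).2.1, (hloc y hy).2.2.1⟩)
    (fun y hy ↦ (hloc y hy).2.2.2.1) (fun y hy ↦ (hloc y hy).2.2.2.2.1)
    (fun y hy ↦ (hloc y hy).2.2.2.2.2)
  refine ⟨max R₁ (max R₂ R₃), T, hRR₁.trans (le_max_left _ _), ?_, ?_⟩
  · -- smoothness of `T` on the smaller far region, pointwise from stub 1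
    intro y hy
    have hy₁ : R₁ < Literature.Geometry.Lorentzian.Kerr.radius 0 y := lt_of_le_of_lt (le_max_left _ _) hy
    exact (hloc y hy₁).2.1.contDiffWithinAt
  · intro y hy
    have hy₁ : R₁ < Literature.Geometry.Lorentzian.Kerr.radius 0 y := lt_of_le_of_lt (le_max_left _ _) hy
    have hy₂ : R₂ < Literature.Geometry.Lorentzian.Kerr.radius 0 y :=
      lt_of_le_of_lt ((le_max_left _ _).trans (le_max_right _ _)) hy
    have hy₃ : R₃ < Literature.Geometry.Lorentzian.Kerr.radius 0 y :=
      lt_of_le_of_lt ((le_max_right _ _).trans (le_max_right _ _)) hy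
    refine ⟨?_, fun v w ↦ hKilling y hy₁ v w⟩
    -- timelikeness: stub 3 with `β := h y`, the bound being the `m = 0` instance of L's `C^k·(1/r)` hypothesis
    have hyreg : y ∈ Literature.Geometry.Lorentzian.Kerr.region (0 : ℝ) R := by
      rw [Literature.Geometry.Lorentzian.Kerr.mem_region, max_eq_left hRpos.le]
      exact lt_of_le_of_lt hRR₁ hy₁
    have hb := hbd 0 (Nat.zero_le k) ⟨y, hyreg⟩
    have hnorm : ‖h y‖ * Literature.Geometry.Lorentzian.Kerr.radius 0 y ≤ C := by
      simpa [norm_iteratedFDeriv_zero] using hb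
    exact hneg y hy₂ (h y) hnorm (T y) (hR₃ y hy₃)

/-- The crux by name, closed modulo the three registered stubs (the hand-over `stub ↦ binder` is definitional). -/
theorem farZoneEternalPapapetrou_of_stubs :
    Summit.FinalStateConjecture.FinalStateConjecture.Theses.EternalPapapetrou.FarZoneEternalPapapetrou :=
  FarZoneEternalPapapetrou_of stub_stationaryChart stub_killing_of_stationaryChart stub_timelike_near_infinity

end Summit.FinalStateConjecture.FinalStateConjecture.Cruxes.FarZoneEternalPapapetrou.Birth

end
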